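import Literature.NumberTheory.Transcendental.Analytification
import HarnessLib

/-!
# (U)-HEAD glue, part L5 — transfer of the analytic clauses along an open immersion on complex points

Topic `AlgebraicGeometry/Motives` (generic); namespace `Literature.AlgebraicGeometry.Motives.AlgPoints`.
KERNEL ONLY: theorems; no definition, no named fact, no instance, no `sorry`.  Cell `hodgecm-mathlib`, (U)-HEAD glue
(census `typers/CENSUS-Uglue.B-p21g13.md` §2 L5, B-plan2 (g10) road (R1) 2026-08-29).

For an open immersion `ι : S ⟶ X` of `k`-schemes the map `map ι : S(ℂ) → X(ℂ)` is an open embedding of complex points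
([SGA1] XII Thm. 1.1 a), ★ `AlgPoints.isOpenEmbedding_map_holds`).  Hence a map `f : M → X(ℂ)` on a topological space
`M` whose values on `D ⊆ M` lie in the image of `S(ℂ)` LIFTS to `Function.invFun (map ι) ∘ f : M → S(ℂ)`, and the lift
inherits continuity on `D`, openness of the restriction to `D`, surjectivity onto `S(ℂ)` (when `ι(S)(ℂ) ⊆ f(D)`), the
fibres of `f`, and holomorphy of the coordinates: for an open `U ⊆ S` and a section `s ∈ Γ(S, U)` the value of `s` at the
lifted point is the value of the transported section `(ι.appIso U)⁻¹ s ∈ Γ(X, ι(U))` at `f` (`evalOrZero_image_map`).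
These are the (U2+) clauses of ★ `siegelModuli_complexUniformisation` moved from `𝓜 ⊗ ℂ` to a piece `S_c ↪ 𝓜 ⊗ ℂ`.

## References
* [SGA1] A. Grothendieck, M. Raynaud, *Revêtements étales et groupe fondamental*, Exp. XII Thm. 1.1 (proof a)), Prop. 3.1 (xi).
* [MumfordFogartyKirwan1994] D. Mumford, J. Fogarty, F. Kirwan, *Geometric Invariant Theory*, App. to Ch. 7 §A (pp. 234–235).
-/

set_option autoImplicit false

open CategoryTheory AlgebraicGeometry Topology

namespace Literature.AlgebraicGeometry.Motives.AlgPoints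

universe u

variable {k : Type u} [Field k] {S X : SchemeOver k} {L : Type u} [Field L] [Algebra k L]

/-! ### §1. The point of a lifted point; values of transported sections -/

/-- For an open immersion `ι : S ⟶ X`, the underlying point of `map ι P` lies in `ι(U)` iff that of `P` lies in `U`.
[cite: SGA1, Exp. XII Thm. 1.1 (proof a))] -/
theorem pt_map_mem_image_iff (ι : S ⟶ X) [IsOpenImmersion ι.left] (U : S.left.Opens) (P : AlgPoints S L) :
    (map ι P).pt ∈ ι.left ''ᵁ U ↔ P.pt ∈ U := by
  rw [pt_map]
  exact ⟨fun h => by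
    obtain ⟨x, hx, hxe⟩ := h
    exact ι.left.isOpenEmbedding.injective hxe ▸ hx, fun h => ⟨P.pt, h, rfl⟩⟩

/-- **Values of a section at a lifted point**: for an open immersion `ι : S ⟶ X`, an open `U ⊆ S`, a section
`s ∈ Γ(S, U)` and `P ∈ S(L)`, the (total) value of the transported section `(ι.appIso U)⁻¹ s ∈ Γ(X, ι(U))` at `map ι P`
equals the value of `s` at `P` (both junk `0` off `U`).  [cite: SGA1, Exp. XII Thm. 1.1 (proof a))] -/
theorem evalOrZero_image_map (ι : S ⟶ X) [IsOpenImmersion ι.left] (U : S.left.Opens)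
    (s : Γ(S.left, U)) (P : AlgPoints S L) :
    evalOrZero (ι.left ''ᵁ U) ((ι.left.appIso U).inv s) (map ι P) = evalOrZero U s P := by
  by_cases hP : P.pt ∈ U
  · have hmem : P ∈ basicSet U s {evalOrZero U s P} := by
      rw [basicSet_eq_setOf]
      exact ⟨hP, rfl⟩
    rw [← preimage_map_basicSet_image ι U s, Set.mem_preimage, basicSet_eq_setOf] at hmem
    exact hmem.2
  · rw [evalOrZero_of_not_mem s hP, evalOrZero_of_not_mem]
    rwa [pt_map_mem_image_iff]

/-! ### §2. Lifting a map into `X(L)` with values in `ι(S)(L)` -/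

section Lift

variable (ι : S ⟶ X) [Nonempty (AlgPoints S L)] {M : Type*} {D : Set M} {f : M → AlgPoints X L}

/-- The lift `Function.invFun (map ι) ∘ f` maps back to `f` wherever `f` takes values in `ι(S)(L)`.
[cite: SGA1, Exp. XII Thm. 1.1 (proof a))] -/
theorem map_invFun_apply {Z : M} (hZ : f Z ∈ Set.range (map ι : AlgPoints S L → AlgPoints X L)) :
    map ι (Function.invFun (map ι) (f Z)) = f Z :=
  Function.invFun_eq hZ

/-- **Continuity transfers to the lift** (`map ι` is an embedding). [cite: SGA1, Exp. XII Thm. 1.1 (proof a))] -/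
theorem continuousOn_invFun_comp [TopologicalSpace L] [TopologicalSpace M] [IsOpenImmersion ι.left] (hf : ContinuousOn f D)
    (hD : ∀ Z ∈ D, f Z ∈ Set.range (map ι : AlgPoints S L → AlgPoints X L)) :
    ContinuousOn (Function.invFun (map ι : AlgPoints S L → AlgPoints X L) ∘ f) D := by
  rw [(isOpenEmbedding_map_holds ι).isEmbedding.isInducing.continuousOn_iff]
  refine hf.congr fun Z hZ => ?_
  simp only [Function.comp_apply]
  exact Function.invFun_eq (hD Z hZ)

/-- **Openness transfers to the lift**: if `f|_D` is an open map into `X(L)`, so is the lift `D → S(L)` (an open subset of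
`D` goes to `(map ι)⁻¹` of its open `f`-image). [cite: SGA1, Exp. XII Thm. 1.1 (proof a))] -/
theorem isOpenMap_restrict_invFun_comp [TopologicalSpace L] [TopologicalSpace M] [IsOpenImmersion ι.left]
    (hf : IsOpenMap (D.restrict f))
    (hD : ∀ Z ∈ D, f Z ∈ Set.range (map ι : AlgPoints S L → AlgPoints X L)) :
    IsOpenMap (D.restrict (Function.invFun (map ι : AlgPoints S L → AlgPoints X L) ∘ f)) := by
  intro W hW
  have himage : D.restrict (Function.invFun (map ι : AlgPoints S L → AlgPoints X L) ∘ f) '' W =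
      (map ι : AlgPoints S L → AlgPoints X L) ⁻¹' (D.restrict f '' W) := by
    ext Q
    constructor
    · rintro ⟨Z, hZW, rfl⟩
      refine ⟨Z, hZW, ?_⟩
      simp only [Set.restrict_apply, Function.comp_apply]
      exact (Function.invFun_eq (hD Z.1 Z.2)).symm
    · rintro ⟨Z, hZW, hZQ⟩
      refine ⟨Z, hZW, ?_⟩
      apply map_injective ι
      simp only [Set.restrict_apply, Function.comp_apply]
      rw [Function.invFun_eq (hD Z.1 Z.2)]
      exact hZQ
  rw [himage]
  exact (hf W hW).preimage (continuous_map ι)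

/-- **Surjectivity of the lift onto `S(L)`** when `ι(S)(L) ⊆ f(D)`. [cite: SGA1, Exp. XII Thm. 1.1 (proof a))] -/
theorem surjOn_invFun_comp [IsOpenImmersion ι.left] (hD : ∀ Z ∈ D, f Z ∈ Set.range (map ι : AlgPoints S L → AlgPoints X L))
    (hD' : Set.range (map ι : AlgPoints S L → AlgPoints X L) ⊆ f '' D) :
    Set.SurjOn (Function.invFun (map ι : AlgPoints S L → AlgPoints X L) ∘ f) D Set.univ := by
  intro Q _
  obtain ⟨Z, hZD, hZQ⟩ := hD' ⟨Q, rfl⟩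
  refine ⟨Z, hZD, map_injective ι ?_⟩
  simp only [Function.comp_apply]
  rw [Function.invFun_eq (hD Z hZD), hZQ]

/-- **The lift has the fibres of `f`** on `D`. [cite: SGA1, Exp. XII Thm. 1.1 (proof a))] -/
theorem invFun_comp_apply_eq_iff (hD : ∀ Z ∈ D, f Z ∈ Set.range (map ι : AlgPoints S L → AlgPoints X L))
    {Z Z' : M} (hZ : Z ∈ D) (hZ' : Z' ∈ D) :
    (Function.invFun (map ι : AlgPoints S L → AlgPoints X L) ∘ f) Z =
        (Function.invFun (map ι : AlgPoints S L → AlgPoints X L) ∘ f) Z' ↔ f Z = f Z' := by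
  constructor
  · intro h
    rw [← Function.invFun_eq (hD Z hZ), ← Function.invFun_eq (hD Z' hZ')]
    exact congrArg (map ι) h
  · intro h
    simp only [Function.comp_apply, h]

/-- **The points of the lift lying in an open `U ⊆ S`** are the points of `D` that `f` sends into `ι(U)`.
[cite: SGA1, Exp. XII Thm. 1.1 (proof a))] -/
theorem inter_preimage_invFun_comp_eq [IsOpenImmersion ι.left] (hD : ∀ Z ∈ D, f Z ∈ Set.range (map ι : AlgPoints S L → AlgPoints X L))
    (U : S.left.Opens) :
    D ∩ (Function.invFun (map ι : AlgPoints S L → AlgPoints X L) ∘ f) ⁻¹' {P | P.pt ∈ U} =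
      D ∩ f ⁻¹' {Q | Q.pt ∈ ι.left ''ᵁ U} := by
  ext Z
  simp only [Set.mem_inter_iff, Set.mem_preimage, Set.mem_setOf_eq, Function.comp_apply]
  constructor
  · rintro ⟨hZ, hU⟩
    refine ⟨hZ, ?_⟩
    rw [← Function.invFun_eq (hD Z hZ), pt_map_mem_image_iff]
    exact hU
  · rintro ⟨hZ, hU⟩
    refine ⟨hZ, ?_⟩
    rw [← Function.invFun_eq (hD Z hZ), pt_map_mem_image_iff] at hU
    exact hU

end Lift

/-! ### §3. Holomorphy of the coordinates transfers to the lift (`L = ℂ`) -/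

/-- **Holomorphy in affine algebraic coordinates transfers to the lift**: if for every affine open `V ⊆ X` and
`t ∈ Γ(X, V)` the coordinate `Z ↦ t(f(Z))` is holomorphic on `D ∩ f⁻¹(V(ℂ))`, then for every affine open `U ⊆ S` and
`s ∈ Γ(S, U)` the coordinate `Z ↦ s(lift(Z))` is holomorphic on `D ∩ lift⁻¹(U(ℂ))` — take `V = ι(U)` (affine, Mathlib
`IsAffineOpen.image_of_isOpenImmersion`) and `t = (ι.appIso U)⁻¹ s`. [cite: SGA1, Exp. XII Thm. 1.1 (proof a))]
[cite: MumfordFogartyKirwan1994, Appendix to Ch. 7 §A (p. 234)] -/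
theorem differentiableOn_evalOrZero_invFun_comp {k : Type} [Field k] [Algebra k ℂ] {S X : SchemeOver k}
    (ι : S ⟶ X) [IsOpenImmersion ι.left] [Nonempty (AlgPoints S ℂ)]
    {M : Type*} [NormedAddCommGroup M] [NormedSpace ℂ M] {D : Set M} {f : M → AlgPoints X ℂ}
    (hD : ∀ Z ∈ D, f Z ∈ Set.range (map ι : AlgPoints S ℂ → AlgPoints X ℂ))
    (hf : ∀ (V : X.left.affineOpens) (t : X.left.presheaf.obj (Opposite.op (↑V : X.left.Opens))),
      DifferentiableOn ℂ (fun Z ↦ evalOrZero (↑V : X.left.Opens) t (f Z)) (D ∩ f ⁻¹' {Q | Q.pt ∈ (↑V : X.left.Opens)}))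
    (U : S.left.affineOpens) (s : S.left.presheaf.obj (Opposite.op (↑U : S.left.Opens))) :
    DifferentiableOn ℂ
      (fun Z ↦ evalOrZero (↑U : S.left.Opens) s ((Function.invFun (map ι : AlgPoints S ℂ → AlgPoints X ℂ) ∘ f) Z))
      (D ∩ (Function.invFun (map ι : AlgPoints S ℂ → AlgPoints X ℂ) ∘ f) ⁻¹' {P | P.pt ∈ (↑U : S.left.Opens)}) := by
  let V : X.left.affineOpens := ⟨ι.left ''ᵁ (↑U : S.left.Opens), U.2.image_of_isOpenImmersion ι.left⟩
  have h := hf V ((ι.left.appIso (↑U : S.left.Opens)).inv s)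
  rw [inter_preimage_invFun_comp_eq ι hD]
  refine h.congr fun Z hZ => ?_
  simp only [Function.comp_apply]
  rw [← evalOrZero_image_map ι (↑U : S.left.Opens) s, Function.invFun_eq (hD Z hZ.1)]

end Literature.AlgebraicGeometry.Motives.AlgPoints
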